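import Summits.Parity.GeneralizedHardyLittlewood.Theorems.PrimeLevelFamEdgeMomentsBeyondDiagonalDiagDecorPrimeSqCross
import Summits.Parity.GeneralizedHardyLittlewood.Theorems.PrimeLevelFamEdgeMomentsBeyondDiagonalDiagDecorPrimePowTwo
import HarnessLib

/-!
# Route `PrimeLevelFamEdge`, crux K_A `MomentsBeyondDiagonal` (stmt-Parity-20007), line «petersson_layers» v4, stub `stub_diag`:
# **the GENERAL cross term of a product decoration `P_{m+1}·P_{i+1}`:
# `Σ_p log^{m+1}p·a_n(p)·Σ_{k′}a_{np}(k′)logᶜ(y/(pk′))P_{i+1}(k′) = 4c(c−1)q_iq′·E_n·log^{c+i+m}y + O(D(n)(1+κ(n))(1+log y)^{c+i+m−1})`**,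
# `q_i = i!(c−2)!/(c+i−1)!`, `q′ = m!(c+i−1)!/(c+i+m)!` (`c ≥ 2`)

Generalises `…DiagDecorPrimeSqCross.abs_primeSqCross_sub_le` (`m = i = 1`) to all `(m, i)`: with the mixed double peel
`…DiagDecorPrimePowPeelMixed.sum_copTauW_mul_primePow_mul_primePow_eq` it evaluates every two-factor decoration `P_a·P_b` of the
higher central divisor-log moments (`M₆ = τ(15P₂³ − 30P₂P₄ + 16P₆)`: the `P₂P₄` family), the inner sums being the `P_{i+1}`-decorated
coprime sums of `…DiagDecorPrimePowTwo` at modulus `np`, the prime sum the Mertens moment of `…DiagPrimeSumLogPow` (`j = m`):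

* `abs_primePowCross_term_sub_le` — the termwise bound;
* `abs_primePowCross_sub_le` — **the displayed asymptotic**.

Def-free; theorems only. Helper `--supports stmt-Parity-20007`; closes nothing; K_A, K_B and the Parity summit are NOT proved;
nothing about Landau–Siegel zeros.

## References
* E. Kowalski, P. Michel, J. VanderKam, J. reine angew. Math. 526 (2000), (23)–(28) pp. 13–15 and Prop. 5.1 p. 18.
  [cite: KowalskiMichelVanderKam2000, (23)–(28) — derivation (prime-power-log decorations of the Selberg coordinates)]
* T. M. Apostol, *Introduction to Analytic Number Theory*, Springer 1976, Thm 4.9 (Mertens). [cite: Apostol1976, Thm 4.9 — derivation]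
-/

noncomputable section

open scoped Real
open Finset ArithmeticFunction

namespace Summit.Parity.GeneralizedHardyLittlewood.Theorems.MomentsBeyondDiagonal.DiagKernel

open Literature.NumberTheory.LFunctions Literature.NumberTheory.LFunctions.KMV2000
open SelbergCoord (kappa)
open Summit.Parity.GeneralizedHardyLittlewood.Theorems.BeyondDiagonalBeatsQuarter.KernelFormXSq
  (copTauW copTauW_apply copTauW_apply_prime mainConst divWeight divWeight_nonneg mainConst_nonneg mainConst_le_divWeight
    divWeight_prime_mul_le sum_prime_log_div_succ_le)

/-- Termwise bound for the general cross term: with `C` the constant of `…DecorPrimePowTwo.abs_coprimeSumPow_primePow_add_le_of_two_le i`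
(main coefficient `q = i!(c−2)!/(c−2+i+1)! ≥ 0`), for `p ≤ y`:
`|[p prime]·log^{m+1}p·a_n(p)·Σ_{k′}a_{np}(k′)logᶜ(y/(pk′))P_{i+1}(k′) − 4c(c−1)q·E_n·v(p)·log^m p·log^{c+i−1}(y/p)| ≤
[p prime, p∤n]·(log p/(p+1))·16C·D(n)(1+κ(n))(1+log y)^{c−2+i}log^m y`. [cite: KowalskiMichelVanderKam2000, (23)–(28) — derivation] -/
theorem abs_primePowCross_term_sub_le (m i : ℕ) {c : ℕ} {C : ℝ} (hC0 : 0 ≤ C) {q : ℝ}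
    (hC : ∀ n : ℕ, n ≠ 0 → ∀ y : ℝ, 1 ≤ y →
      |∑ k ∈ Icc 1 ⌊y⌋₊, copTauW n k * Real.log (y / k) ^ c * ∑ p ∈ k.primeFactors, Real.log p ^ (i + 1) +
          2 * ((c : ℝ) * ((c : ℝ) - 1)) * q * mainConst n * Real.log y ^ (c - 2 + i + 1)| ≤
        C * divWeight n * (1 + kappa n) * (1 + Real.log y) ^ (c - 2 + i))
    {n : ℕ} (hn : n ≠ 0) {y : ℝ} (hy : 1 ≤ y) {p : ℕ} (hp : p ∈ Icc 1 ⌊y⌋₊) :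
    |(if p.Prime then Real.log p ^ (m + 1) * copTauW n p *
          ∑ k ∈ Icc 1 (⌊y⌋₊ / p), copTauW (n * p) k *
            (Real.log (y / ((p * k : ℕ) : ℝ)) ^ c * ∑ q' ∈ k.primeFactors, Real.log q' ^ (i + 1)) else 0) -
        (4 * ((c : ℝ) * ((c : ℝ) - 1)) * q * mainConst n) *
          ((if p.Prime ∧ ¬ p ∣ n then Real.log p / ((p : ℝ) - 1) else 0) *
            (Real.log p ^ m * Real.log (y / p) ^ (c - 2 + i + 1)))| ≤
      if p.Prime ∧ ¬ p ∣ n then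
        Real.log p / ((p : ℝ) + 1) *
          (16 * C * divWeight n * (1 + kappa n) * (1 + Real.log y) ^ (c - 2 + i) * Real.log y ^ m)
      else 0 := by
  obtain ⟨hp0, hpy, hyp1, hlp0, hlpy, hL0, hLy⟩ := prime_range_facts hy hp
  have hD := divWeight_nonneg n
  have hly : 0 ≤ Real.log y := Real.log_nonneg hy
  have hκ : 0 ≤ kappa n := by
    unfold kappa
    exact Finset.sum_nonneg fun q hq ↦ by
      have hq2 : (2 : ℝ) ≤ q := by exact_mod_cast (Nat.prime_of_mem_primeFactors hq).two_le
      exact div_nonneg (Real.log_nonneg (by linarith)) (by linarith)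
  by_cases hpr : p.Prime
  · by_cases hpn : p ∣ n
    · have h0 : copTauW n p = 0 := by rw [copTauW_apply_prime hpr, if_pos hpn]
      have hneg : ¬ (p.Prime ∧ ¬ p ∣ n) := fun h ↦ h.2 hpn
      rw [if_pos hpr, if_neg hneg, if_neg hneg, h0]
      simp
    · have hpos : p.Prime ∧ ¬ p ∣ n := ⟨hpr, hpn⟩
      -- reindex the inner sum at scale `y/p`
      have hre : ∑ k ∈ Icc 1 (⌊y⌋₊ / p), copTauW (n * p) k *
            (Real.log (y / ((p * k : ℕ) : ℝ)) ^ c * ∑ q' ∈ k.primeFactors, Real.log q' ^ (i + 1)) =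
          ∑ k ∈ Icc 1 ⌊y / p⌋₊, copTauW (n * p) k * Real.log (y / p / k) ^ c *
            ∑ q' ∈ k.primeFactors, Real.log q' ^ (i + 1) := by
        rw [← Nat.floor_div_natCast]
        refine Finset.sum_congr rfl fun k _ ↦ ?_
        rw [Nat.cast_mul, div_div]
        ring
      rw [if_pos hpr, if_pos hpos, if_pos hpos, copTauW_apply_prime hpr, if_neg hpn, hre]
      have hnp : n * p ≠ 0 := mul_ne_zero hn hpr.ne_zero
      have hin := hC (n * p) hnp (y / p) hyp1
      set S := ∑ k ∈ Icc 1 ⌊y / p⌋₊, copTauW (n * p) k * Real.log (y / p / k) ^ c *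
        ∑ q' ∈ k.primeFactors, Real.log q' ^ (i + 1) with hS
      set err := S + 2 * ((c : ℝ) * ((c : ℝ) - 1)) * q * mainConst (n * p) * Real.log (y / p) ^ (c - 2 + i + 1) with herr
      -- the size of the inner error
      have hDnp : divWeight (n * p) ≤ 2 * divWeight n := by
        rw [mul_comm]; exact divWeight_prime_mul_le hpr hn
      have hκnp : 1 + kappa (n * p) ≤ 2 * (1 + kappa n) := by
        have := kappa_mul_prime_le hn hpr; linarith
      have hκnp0 : 0 ≤ 1 + kappa (n * p) := by
        have : 0 ≤ kappa (n * p) := by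
          unfold kappa
          exact Finset.sum_nonneg fun q hq ↦ by
            have hq2 : (2 : ℝ) ≤ q := by exact_mod_cast (Nat.prime_of_mem_primeFactors hq).two_le
            exact div_nonneg (Real.log_nonneg (by linarith)) (by linarith)
        linarith
      have hpow : (1 + Real.log (y / p)) ^ (c - 2 + i) ≤ (1 + Real.log y) ^ (c - 2 + i) :=
        pow_le_pow_left₀ (by linarith) (by linarith) _
      have herr_le : |err| ≤ 4 * C * divWeight n * (1 + kappa n) * (1 + Real.log y) ^ (c - 2 + i) := by
        calc |err| ≤ C * divWeight (n * p) * (1 + kappa (n * p)) * (1 + Real.log (y / p)) ^ (c - 2 + i) := hin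
          _ ≤ C * (2 * divWeight n) * (2 * (1 + kappa n)) * (1 + Real.log y) ^ (c - 2 + i) := by
              gcongr
          _ = 4 * C * divWeight n * (1 + kappa n) * (1 + Real.log y) ^ (c - 2 + i) := by ring
      -- the main parts cancel by the prime weight transfer
      have hE := log_div_succ_mul_mainConst_mul hn hpr hpn
      have hp1 : (p : ℝ) + 1 ≠ 0 := by linarith
      have hSe : S = -2 * ((c : ℝ) * ((c : ℝ) - 1)) * q * mainConst (n * p) * Real.log (y / p) ^ (c - 2 + i + 1) + err := by
        rw [herr]; ring
      have hkey : Real.log p ^ (m + 1) * (-2 * ((p : ℝ) + 1)⁻¹) * S -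
          (4 * ((c : ℝ) * ((c : ℝ) - 1)) * q * mainConst n) *
            (Real.log p / ((p : ℝ) - 1) * (Real.log p ^ m * Real.log (y / p) ^ (c - 2 + i + 1))) =
          Real.log p ^ (m + 1) * (-2 * ((p : ℝ) + 1)⁻¹) * err := by
        have hE' : mainConst n * (Real.log p / ((p : ℝ) - 1)) = Real.log p * ((p : ℝ) + 1)⁻¹ * mainConst (n * p) := by
          rw [← hE]; rw [div_eq_mul_inv]
        calc _ = Real.log p ^ (m + 1) * (-2 * ((p : ℝ) + 1)⁻¹) * S -
              4 * ((c : ℝ) * ((c : ℝ) - 1)) * q * (mainConst n * (Real.log p / ((p : ℝ) - 1))) *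
                (Real.log p ^ m * Real.log (y / p) ^ (c - 2 + i + 1)) := by ring
          _ = _ := by rw [hE', hSe]; ring
      rw [hkey, abs_mul, abs_mul, abs_of_nonneg (pow_nonneg hlp0 (m + 1))]
      have habs2 : |(-2 : ℝ) * ((p : ℝ) + 1)⁻¹| = 2 * ((p : ℝ) + 1)⁻¹ := by
        rw [abs_mul, abs_inv, abs_of_pos (by linarith : (0 : ℝ) < (p : ℝ) + 1)]
        norm_num
      rw [habs2]
      have hpm : Real.log p ^ m ≤ Real.log y ^ m := pow_le_pow_left₀ hlp0 hlpy m
      calc Real.log p ^ (m + 1) * (2 * ((p : ℝ) + 1)⁻¹) * |err|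
          ≤ Real.log p ^ (m + 1) * (2 * ((p : ℝ) + 1)⁻¹) *
              (4 * C * divWeight n * (1 + kappa n) * (1 + Real.log y) ^ (c - 2 + i)) :=
            mul_le_mul_of_nonneg_left herr_le (by positivity)
        _ = Real.log p / ((p : ℝ) + 1) *
              (16 * C * divWeight n * (1 + kappa n) * (1 + Real.log y) ^ (c - 2 + i) * (Real.log p ^ m / 2)) := by
            rw [div_eq_mul_inv, pow_succ]; ring
        _ ≤ Real.log p / ((p : ℝ) + 1) *
              (16 * C * divWeight n * (1 + kappa n) * (1 + Real.log y) ^ (c - 2 + i) * Real.log y ^ m) := by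
            have : Real.log p ^ m / 2 ≤ Real.log y ^ m := by
              have h0 : 0 ≤ Real.log p ^ m := pow_nonneg hlp0 m
              linarith
            gcongr
  · have hneg : ¬ (p.Prime ∧ ¬ p ∣ n) := fun h ↦ hpr h.1
    rw [if_neg hpr, if_neg hneg, if_neg hneg]
    simp

/-- **The general cross term `P_{m+1} ⊗ P_{i+1}`** (`c ≥ 2`): there is `C` with, for all `n ≥ 1`, `y ≥ 1`,
`|Σ_{p≤y prime}log^{m+1}p·a_n(p)·Σ_{k′≤⌊y⌋/p}a_{np}(k′)logᶜ(y/(pk′))P_{i+1}(k′)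
  − 4c(c−1)·(i!(c−2)!/(c−2+i+1)!)·(m!(c−2+i+1)!/(c−2+i+1+m+1)!)·E_n·log^{c−2+i+1+m+1}y| ≤ C·D(n)(1+κ(n))(1+log y)^{c−2+i+1+m}`
(`m = i = 1`: `…DiagDecorPrimeSqCross.abs_primeSqCross_sub_le`, main `+4E_n log^{c+2}y/((c+1)(c+2))`).
[cite: KowalskiMichelVanderKam2000, (23)–(28) and Prop. 5.1 — derivation (product prime-power-log decorations, real variables)] -/
theorem abs_primePowCross_sub_le (m i : ℕ) {c : ℕ} (hc : 2 ≤ c) :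
    ∃ C : ℝ, 0 < C ∧ ∀ n : ℕ, n ≠ 0 → ∀ y : ℝ, 1 ≤ y →
      |∑ p ∈ (Icc 1 ⌊y⌋₊).filter Nat.Prime, Real.log p ^ (m + 1) * copTauW n p *
          ∑ k ∈ Icc 1 (⌊y⌋₊ / p), copTauW (n * p) k *
            (Real.log (y / ((p * k : ℕ) : ℝ)) ^ c * ∑ q' ∈ k.primeFactors, Real.log q' ^ (i + 1)) -
          4 * ((c : ℝ) * ((c : ℝ) - 1)) * ((i.factorial : ℝ) * (c - 2).factorial / (c - 2 + i + 1).factorial) *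
            ((m.factorial : ℝ) * (c - 2 + i + 1).factorial / (c - 2 + i + 1 + m + 1).factorial) *
            mainConst n * Real.log y ^ (c - 2 + i + 1 + m + 1)| ≤
        C * divWeight n * (1 + kappa n) * (1 + Real.log y) ^ (c - 2 + i + 1 + m) := by
  obtain ⟨C, hC0, hC⟩ := abs_coprimeSumPow_primePow_add_le_of_two_le i hc
  obtain ⟨C_E, hC_E, hE⟩ := mainConst_le_divWeight
  set q : ℝ := (i.factorial : ℝ) * (c - 2).factorial / (c - 2 + i + 1).factorial with hq
  have hq0 : 0 ≤ q := by positivity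
  set q' : ℝ := (m.factorial : ℝ) * (c - 2 + i + 1).factorial / (c - 2 + i + 1 + m + 1).factorial with hq'
  have hq'0 : 0 ≤ q' := by positivity
  refine ⟨32 * C + 76 * 2 ^ m * (c : ℝ) ^ 2 * q * C_E, by positivity, fun n hn y hy ↦ ?_⟩
  have hy0 : 0 < y := by linarith
  have hly : 0 ≤ Real.log y := Real.log_nonneg hy
  have hκ : 0 ≤ kappa n := by
    unfold kappa
    exact Finset.sum_nonneg fun p hp ↦ by
      have hp2 : (2 : ℝ) ≤ p := by exact_mod_cast (Nat.prime_of_mem_primeFactors hp).two_le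
      exact div_nonneg (Real.log_nonneg (by linarith)) (by linarith)
  have hD := divWeight_nonneg n
  have hE0 := mainConst_nonneg n
  have hEn := hE n hn
  have hcc : 0 ≤ (c : ℝ) * ((c : ℝ) - 1) := by
    have : (2 : ℝ) ≤ c := by exact_mod_cast hc
    nlinarith
  have hl4 : Real.log 4 ≤ 2 := by
    have := Real.log_two_lt_d9
    have h4 : Real.log 4 = 2 * Real.log 2 := by
      rw [show (4 : ℝ) = 2 ^ 2 by norm_num, Real.log_pow]; ring
    rw [h4]; linarith
  have hl40 : 0 ≤ Real.log 4 := Real.log_nonneg (by norm_num)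
  set N := ⌊y⌋₊ with hN
  have hN1 : 1 ≤ N := by rw [hN]; exact Nat.one_le_floor_iff _ |>.2 hy
  have hlogN : Real.log N ≤ Real.log y :=
    Real.log_le_log (by exact_mod_cast hN1) (Nat.floor_le hy0.le)
  have hlogN0 : 0 ≤ Real.log N := Real.log_natCast_nonneg N
  rw [Finset.sum_filter]
  obtain ⟨T, hT⟩ : ∃ T : ℕ → ℝ, ∀ p, T p = if p.Prime then Real.log p ^ (m + 1) * copTauW n p *
      ∑ k ∈ Icc 1 (N / p), copTauW (n * p) k *
        (Real.log (y / ((p * k : ℕ) : ℝ)) ^ c * ∑ q' ∈ k.primeFactors, Real.log q' ^ (i + 1)) else 0 :=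
    ⟨_, fun _ ↦ rfl⟩
  obtain ⟨v, hv⟩ : ∃ v : ℕ → ℝ, ∀ p, v p = if p.Prime ∧ ¬ p ∣ n then Real.log p / ((p : ℝ) - 1) else 0 :=
    ⟨_, fun _ ↦ rfl⟩
  simp only [← hT]
  set K : ℝ := 16 * C * divWeight n * (1 + kappa n) * (1 + Real.log y) ^ (c - 2 + i) * Real.log y ^ m with hK
  have hK0 : 0 ≤ K := by positivity
  set k : ℝ := 4 * ((c : ℝ) * ((c : ℝ) - 1)) * q * mainConst n with hk
  have hmain := abs_sum_primeWeight_coprime_logPow_mul_log_pow_sub_le hn hy m (c - 2 + i + 1)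
  simp only [← hv] at hmain
  rw [← hq'] at hmain
  have hterm : ∀ p ∈ Icc 1 N, |T p - k * (v p * (Real.log p ^ m * Real.log (y / p) ^ (c - 2 + i + 1)))| ≤
      if p.Prime ∧ ¬ p ∣ n then Real.log p / ((p : ℝ) + 1) * K else 0 := by
    intro p hp
    rw [hT p, hv p]
    exact abs_primePowCross_term_sub_le m i hC0.le hC hn hy hp
  have hsplit : ∑ p ∈ Icc 1 N, T p - 4 * ((c : ℝ) * ((c : ℝ) - 1)) * q * q' * mainConst n *
        Real.log y ^ (c - 2 + i + 1 + m + 1) =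
      ∑ p ∈ Icc 1 N, (T p - k * (v p * (Real.log p ^ m * Real.log (y / p) ^ (c - 2 + i + 1)))) +
        k * (∑ p ∈ Icc 1 N, v p * (Real.log p ^ m * Real.log (y / p) ^ (c - 2 + i + 1)) -
          q' * Real.log y ^ (c - 2 + i + 1 + m + 1)) := by
    rw [Finset.sum_sub_distrib, ← Finset.mul_sum, hk]
    ring
  rw [hsplit]
  have hA : |∑ p ∈ Icc 1 N, (T p - k * (v p * (Real.log p ^ m * Real.log (y / p) ^ (c - 2 + i + 1))))| ≤
      K * (Real.log N + Real.log 4) := by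
    calc _ ≤ ∑ p ∈ Icc 1 N, |T p - k * (v p * (Real.log p ^ m * Real.log (y / p) ^ (c - 2 + i + 1)))| :=
          Finset.abs_sum_le_sum_abs _ _
      _ ≤ ∑ p ∈ Icc 1 N, (if p.Prime ∧ ¬ p ∣ n then Real.log p / ((p : ℝ) + 1) * K else 0) :=
          Finset.sum_le_sum hterm
      _ ≤ K * (Real.log N + Real.log 4) := sum_prime_log_div_succ_le n N hK0
  have hB : |k * (∑ p ∈ Icc 1 N, v p * (Real.log p ^ m * Real.log (y / p) ^ (c - 2 + i + 1)) -
      q' * Real.log y ^ (c - 2 + i + 1 + m + 1))| ≤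
      4 * ((c : ℝ) * ((c : ℝ) - 1)) * q * mainConst n * (2 ^ m * (19 + kappa n) * (1 + Real.log y) ^ (c - 2 + i + 1 + m)) := by
    rw [abs_mul]
    have hkabs : |k| = 4 * ((c : ℝ) * ((c : ℝ) - 1)) * q * mainConst n := by
      rw [hk, abs_mul, abs_mul, abs_mul, abs_of_nonneg hcc, abs_of_nonneg hq0, abs_of_nonneg hE0]
      norm_num
    rw [hkabs]
    exact mul_le_mul_of_nonneg_left hmain (by positivity)
  have hX0 : 0 ≤ (1 + Real.log y) ^ (c - 2 + i + 1 + m) := by positivity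
  have hpow : (1 + Real.log y) ^ (c - 2 + i) * Real.log y ^ m * (Real.log N + Real.log 4) ≤
      2 * (1 + Real.log y) ^ (c - 2 + i + 1 + m) := by
    have e : c - 2 + i + 1 + m = (c - 2 + i) + m + 1 := by omega
    have h1 : Real.log y ^ m ≤ (1 + Real.log y) ^ m := pow_le_pow_left₀ hly (by linarith) m
    have h2 : Real.log N + Real.log 4 ≤ 2 * (1 + Real.log y) := by linarith
    have hA : Real.log y ^ m * (Real.log N + Real.log 4) ≤ (1 + Real.log y) ^ m * (2 * (1 + Real.log y)) :=
      mul_le_mul h1 h2 (add_nonneg hlogN0 hl40) (by positivity)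
    calc (1 + Real.log y) ^ (c - 2 + i) * Real.log y ^ m * (Real.log N + Real.log 4)
        = (1 + Real.log y) ^ (c - 2 + i) * (Real.log y ^ m * (Real.log N + Real.log 4)) := by ring
      _ ≤ (1 + Real.log y) ^ (c - 2 + i) * ((1 + Real.log y) ^ m * (2 * (1 + Real.log y))) :=
          mul_le_mul_of_nonneg_left hA (by positivity)
      _ = 2 * (1 + Real.log y) ^ (c - 2 + i + 1 + m) := by rw [e, pow_add, pow_succ]; ring
  have hfirst : K * (Real.log N + Real.log 4) ≤ 32 * C * divWeight n * (1 + kappa n) * (1 + Real.log y) ^ (c - 2 + i + 1 + m) := by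
    calc K * (Real.log N + Real.log 4)
        = 16 * C * divWeight n * (1 + kappa n) *
            ((1 + Real.log y) ^ (c - 2 + i) * Real.log y ^ m * (Real.log N + Real.log 4)) := by rw [hK]; ring
      _ ≤ 16 * C * divWeight n * (1 + kappa n) * (2 * (1 + Real.log y) ^ (c - 2 + i + 1 + m)) :=
          mul_le_mul_of_nonneg_left hpow (by positivity)
      _ = 32 * C * divWeight n * (1 + kappa n) * (1 + Real.log y) ^ (c - 2 + i + 1 + m) := by ring
  have hsecond : 4 * ((c : ℝ) * ((c : ℝ) - 1)) * q * mainConst n *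
        (2 ^ m * (19 + kappa n) * (1 + Real.log y) ^ (c - 2 + i + 1 + m)) ≤
      76 * 2 ^ m * (c : ℝ) ^ 2 * q * C_E * divWeight n * (1 + kappa n) * (1 + Real.log y) ^ (c - 2 + i + 1 + m) := by
    have i1 : (c : ℝ) * ((c : ℝ) - 1) ≤ (c : ℝ) ^ 2 := by nlinarith [(Nat.cast_nonneg c : (0 : ℝ) ≤ c)]
    have i2 : 19 + kappa n ≤ 19 * (1 + kappa n) := by linarith
    have i3 : ((c : ℝ) * ((c : ℝ) - 1)) * ((19 + kappa n) * mainConst n) ≤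
        (c : ℝ) ^ 2 * ((19 * (1 + kappa n)) * (C_E * divWeight n)) :=
      mul_le_mul i1 (mul_le_mul i2 hEn hE0 (by positivity)) (by positivity) (by positivity)
    calc 4 * ((c : ℝ) * ((c : ℝ) - 1)) * q * mainConst n *
          (2 ^ m * (19 + kappa n) * (1 + Real.log y) ^ (c - 2 + i + 1 + m))
        = 4 * 2 ^ m * q * (((c : ℝ) * ((c : ℝ) - 1)) * ((19 + kappa n) * mainConst n)) *
            (1 + Real.log y) ^ (c - 2 + i + 1 + m) := by ring
      _ ≤ 4 * 2 ^ m * q * ((c : ℝ) ^ 2 * ((19 * (1 + kappa n)) * (C_E * divWeight n))) *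
            (1 + Real.log y) ^ (c - 2 + i + 1 + m) := by
          apply mul_le_mul_of_nonneg_right _ hX0
          exact mul_le_mul_of_nonneg_left i3 (by positivity)
      _ = 76 * 2 ^ m * (c : ℝ) ^ 2 * q * C_E * divWeight n * (1 + kappa n) * (1 + Real.log y) ^ (c - 2 + i + 1 + m) := by
          ring
  calc _ ≤ |∑ p ∈ Icc 1 N, (T p - k * (v p * (Real.log p ^ m * Real.log (y / p) ^ (c - 2 + i + 1))))| +
        |k * (∑ p ∈ Icc 1 N, v p * (Real.log p ^ m * Real.log (y / p) ^ (c - 2 + i + 1)) -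
          q' * Real.log y ^ (c - 2 + i + 1 + m + 1))| := abs_add_le _ _
    _ ≤ K * (Real.log N + Real.log 4) + 4 * ((c : ℝ) * ((c : ℝ) - 1)) * q * mainConst n *
        (2 ^ m * (19 + kappa n) * (1 + Real.log y) ^ (c - 2 + i + 1 + m)) := add_le_add hA hB
    _ ≤ 32 * C * divWeight n * (1 + kappa n) * (1 + Real.log y) ^ (c - 2 + i + 1 + m) +
        76 * 2 ^ m * (c : ℝ) ^ 2 * q * C_E * divWeight n * (1 + kappa n) * (1 + Real.log y) ^ (c - 2 + i + 1 + m) :=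
        add_le_add hfirst hsecond
    _ = (32 * C + 76 * 2 ^ m * (c : ℝ) ^ 2 * q * C_E) * divWeight n * (1 + kappa n) *
        (1 + Real.log y) ^ (c - 2 + i + 1 + m) := by ring

end Summit.Parity.GeneralizedHardyLittlewood.Theorems.MomentsBeyondDiagonal.DiagKernel

end
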